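import Summits.QuantumFields.BalabanUV.Beta.GAN24.ContactKernelCells
import Summits.QuantumFields.BalabanUV.Beta.GAN24.GaugeTableSlotByParts
import Summits.QuantumFields.BalabanUV.Beta.GAN24.CoDressedColumnPairing
import Summits.QuantumFields.BalabanUV.Beta.GAN24.LayerSeamLettersFubini
import Summits.QuantumFields.BalabanUV.Beta.GAN24.AxProjBmWindow
import Summits.QuantumFields.BalabanUV.Beta.GAN24.RespStepBmGaugeStep
import Summits.QuantumFields.BalabanUV.Beta.GAN24.SrecBornSector

/-!
# `BalabanUV.Beta.GAN24.ChainTableLegCoClosed` — binder row G-an2-4 ∕ (CONV-C), W-slot CT-W, route «WC-TL» ∕ «QR-LL», row (LT) ∕ K-LL-4, the (Q-R)^{cc} RE-CUT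
# of RULING R-gan24p1-g29-1 (E) (journal l.44562) AT THE COMPOSITE LEVEL: **ON A CO-CLOSED LETTER THE LITERAL's WHOLE CHAIN OF DRESSED ONE-STEP TABLE LEGS IS
# an2's UNDRESSED COMPOSITE COLUMN; ON A FLUX-FREE LETTER IT IS THE ONE-SHOT DRESSED COMPOSITE COLUMN** — the table third of K-LL-4 is ABSENT on co-closed letters
# and costs ONE dressing (the outermost) on flux-free letters, for every depth `k`, exactly, whatever the kernel legs

NOT IN PRINT; OUR BOOKKEEPING ([folklore] kernel algebra BY NAME: leaf-01 g57 ∕ leaf-03 g41's decomposition of the dressed leg chain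
`ContactKernelCells.legChain_respStepBmSeq_apply_eq_add_dz` (`legChain T = respStep + dz λ`, `λ = Ψ(δ) − bmGaugeAt(respStep)`), leaf-01 g66's slot summation by parts
`GaugeTableSlotByParts.vertexW_dz_eq_tsum_mul_divV`, the block regrouping `LayerSeamLettersFubini.tsum_blockConst_mul`, leaf-03's `RespStepBmDecompPsi.Psi` (BLOCK-CONSTANT
by construction), the window bridge `AxProjBmWindow.axProjBmAt_eq_coProjBmW`; G-an2-4 formalisation swarm → CRUX TEAM (2), leaf prover `b2b-balaban-gan24-formalise-leaf-01`, gen 67).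
HONEST FRAMING (cell contract, verbatim): «discharging `BetaPertH` makes Bałaban's UV stability UNCONDITIONAL — a real constructive-QFT result; it is NOT the continuum
limit and NOT the Clay problem.»  HONEST DEPENDENCY (verbatim): «continuum YM on T⁴ ⇐ BetaPertH ∧ nine spine estimates (0/9 proved); BetaPertH ⇐ (D1) ∧ (D4) ∧ CAP+tail;
G-an2-4 gates asym, D1 and NE2/3/4.»

## Why
The END `WardRemainderEndThreeSplit` pushes each sub-letter through ONE three-leg push whose legs are the CHAINS `legChain (respStepBmSeq ρ Lc) m k` of the dressed one-step
columns (`SrecBornSector.transport_unitStepMap_succ_eq_push₃`).  The OWNER's `TableSlotCoDress` §4–§5 (p332309) re-bases ONE level: on a slot-divergence-free letter the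
dressed one-step table leg is the bare one, and co-closedness propagates.  THIS file does the whole chain at once, WITHOUT iterating: the chain differs from the undressed
composite column `respStep (Lc^m) (Lc^(m+k+1))` by a pure gauge `dz λ` in the FINE slot index (tree), and a pure-gauge table leg reads only the letter's slot divergence
(tree) — zero on a co-closed letter.  On a FLUX-free letter (all `Lc`-block fluxes zero) only the block-constant part of `λ` drops: the intermediate gauges `Ψ` (constant
on `Lc`-blocks) are invisible and exactly the OUTERMOST block-mean gauge survives — the chain acts as `respStepBm ρ Lc (Lc^m) (Lc^(m+k+1)) = bmW ρ Lc (respStep …)`, the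
one-shot dressed composite column: «the FIRST dressing costs the base count once, then nothing» (RULING (E) (CC)) as an identity at the composite level.

## What (generic `d`; in-block root `ρ = toSite rr`, `[NeZero Lc]`; every `m k`; `S` slot-summable at each kernel entry)
§1 `tsum_ite_blk_eq_sum_box` (block indicator series = finite block sum), `exists_abs_chainGauge_le` (the chain's gauge function
   `λ_{μz} = Psi ρ Lc m k (δ_{μz}) − bmGaugeAt ρ (respStep (Lc^m) (Lc^(m+k+1)) μ z) Lc` is BOUNDED, uniformly in the coarse bond).
§2 **`vertexW_legChain_eq_add_tsum`**: `vertexW (legChain T m k) S κ′ u′ x z a b = vertexW (respStep …) S κ′ u′ x z a b + Σ'_u λ_{κ′u′}(u)·(divV S u) x z a b`;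
   **`vertexW_legChain_eq_of_divFree`** ∕ **`push₃_legChain_table_eq_of_divFree`**: `divV S ≡ 0 ⇒ vertexW (legChain T m k) S = vertexW (respStep (Lc^m) (Lc^(m+k+1))) S` and
   `push₃ l r (legChain T m k) S = push₃ l r (respStep (Lc^m) (Lc^(m+k+1))) S` for ALL kernel legs `l, r`.
§3 `Psi_delta1_eq_blk` (`Ψ` factors through `blk Lc`), `tsum_blockConst_mul_divV_eq_zero_of_fluxFree`; **`vertexW_legChain_eq_respStepBm_of_fluxFree`** ∕
   **`push₃_legChain_table_eq_respStepBm_of_fluxFree`**: all `Lc`-block fluxes of `S` zero ⇒ `push₃ l r (legChain T m k) S = push₃ l r (respStepBm ρ Lc (Lc^m) (Lc^(m+k+1))) S`.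
§4 THE END's CURRENCY (`SrecBornSector.transport_unitStepMap_succ_eq_push₃` ⨾ §2–§3): for an ff-valued local letter `X` at level `m`, the `(n+1)`-level unit transport is
   `(cE·Lc^{2(d+1)})^{n+1} • push₃ (legChain T m n) (legChain T m n) W X` with the TABLE leg `W = respStep (Lc^m) (Lc^(m+n+1))` if `divV X ≡ 0`
   (**`transport_unitStepMap_succ_eq_push₃_respStep_of_divFree`**) and `W = respStepBm ρ Lc (Lc^m) (Lc^(m+n+1))` if `X` is flux-free
   (**`transport_unitStepMap_succ_eq_push₃_respStepBm_of_fluxFree`**).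
KERNEL legs untouched (they stay the dressed chain `legChain T`; the SAME tree decomposition `legChain T = respStep + dz λ` holds for them, so their gauge parts are leaf-02's
first-slot ∕ second-slot cells `push₃ (dz λ) r w ∕ push₃ l (dz λ) w`, whose fate is the letter's KERNEL-index Ward structure — (ii-G)'s business, not claimed here).
[folklore]; 0 cited facts, 0 `def`, 0 `def … : Prop`, 0 sorry.
NOTHING of (Q-R)∕(LT)∕(Q-L)∕(C)∕(S)∕«T2Shape»∕«T2Drift»∕(hW, hWall) discharged; NEVER «G-an2-4 closed» as (CONV-C); NOT D1, NOT `BetaPertH`, NOT continuum, NOT Clay.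
2026-08-22; no existing file touched.
-/

noncomputable section

open Finset
open scoped BigOperators
open Literature.MathematicalPhysics.QuantumFieldTheory
open Literature.MathematicalPhysics.QuantumFieldTheory.Balaban1983to89
open Literature.MathematicalPhysics.QuantumFieldTheory.Balaban1983to89.Beta
open ExpKernelCalculus (MKer Site)
open OneStepResolventKernel (Fib LocStencil)
open KernelWard (divV)
open AffineAveraging (Form1 box toSite dz)
open AveragingContours (blk off off_mem_box blk_add_off blk_block grad_eq_dz)
open AxialProjector (toSite_injective)
open KKTFluctuationKernel (delta1)
open BalabanCompositeJets (respStep)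
open Summit.QuantumFields.BalabanUV.Beta.AxialProjectorBlockMean (bmGaugeAt axProjBmAt)
open Summit.QuantumFields.BalabanUV.Beta.GAN24.Push4 (vertexW vertexW_apply)
open Summit.QuantumFields.BalabanUV.Beta.GAN24.Push4Iter (LegFam legChain)
open Summit.QuantumFields.BalabanUV.Beta.GAN24.Push3 (push₃ push₃_def)
open Summit.QuantumFields.BalabanUV.Beta.GAN24.RespStepBm (bmW respStepBm respStepBm_def)
open Summit.QuantumFields.BalabanUV.Beta.GAN24.RespStepBmDecompLegs (legAct)
open Summit.QuantumFields.BalabanUV.Beta.GAN24.RespStepBmDecompExact (respStepBmSeq)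
open Summit.QuantumFields.BalabanUV.Beta.GAN24.RespStepBmDecompPsi (Psi Psi_apply)
open Summit.QuantumFields.BalabanUV.Beta.GAN24.RespStepBmDecomp (blk_blk)
open Summit.QuantumFields.BalabanUV.Beta.GAN24.ContactKernelCells (legChain_respStepBmSeq_apply_eq_add_dz legAct_delta1_eq)
open Summit.QuantumFields.BalabanUV.Beta.GAN24.RespStepBmGaugeStep (exists_abs_respStep_le)
open Summit.QuantumFields.BalabanUV.Beta.GAN24.CoDressedColumnPairing (abs_bmGaugeAt_le)
open Summit.QuantumFields.BalabanUV.Beta.GAN24.GaugeTableSlotByParts (vertexW_dz_eq_tsum_mul_divV summable_divV_apply)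
open Summit.QuantumFields.BalabanUV.Beta.GAN24.LayerSeamLettersFubini (tsum_blockConst_mul)
open Summit.QuantumFields.BalabanUV.Beta.GAN24.AxProjBmWindow (axProjBmAt_eq_coProjBmW)
open Summit.QuantumFields.BalabanUV.Beta.GAN24.Push4 (IsFF)
open Summit.QuantumFields.BalabanUV.Beta.GAN24.AffineUnroll (transport)
open Summit.QuantumFields.BalabanUV.Beta.GAN24.SrecBornSector (unitStepMap transport_unitStepMap_succ_eq_push₃)
open Summit.QuantumFields.BalabanUV.Beta.GAN24.CoDressedColumnPairing (summable_stencil_slot)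

namespace Summit.QuantumFields.BalabanUV.Beta.GAN24.ChainTableLegCoClosed

variable {d : ℕ} {Lc : ℕ} [NeZero Lc]

/-! ## §1 Two bricks: the block-indicator series, and the chain's gauge function is bounded -/

omit [NeZero Lc] in
open Classical in
/-- [folklore] The indicator series over one `Lc`-block is the finite block sum (`1 ≤ Lc`). -/
theorem tsum_ite_blk_eq_sum_box (hLc : 1 ≤ Lc) (B : Site (d + 1)) (F : Site (d + 1) → ℝ) :
    ∑' u, (if blk Lc u = B then F u else 0) = ∑ v ∈ box (d + 1) Lc, F ((Lc : ℤ) • B + toSite v) := by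
  rw [tsum_eq_sum (s := (box (d + 1) Lc).image (fun v => (Lc : ℤ) • B + toSite v)) (fun u hu => ?_)]
  · rw [Finset.sum_image (fun v _ w _ h => toSite_injective (add_left_cancel h))]
    refine Finset.sum_congr rfl fun v hv => ?_
    rw [if_pos (blk_block B hv)]
  · have hb : blk Lc u ≠ B := by
      intro hb
      apply hu
      rw [Finset.mem_image]
      exact ⟨off Lc u, off_mem_box hLc u, by rw [← hb, blk_add_off hLc u]⟩
    rw [if_neg hb]

/-- [folklore] **THE CHAIN's GAUGE FUNCTION IS BOUNDED** (uniformly in the coarse bond and the fine site): the `λ_{μz}` of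
`ContactKernelCells.legChain_respStepBmSeq_apply_eq_add_dz` — `Ψ` is a finite sum of block-mean tree gauges of the (uniformly bounded, `exists_abs_respStep_le`)
undressed composite columns, and so is the outermost term (`abs_bmGaugeAt_le`). -/
theorem exists_abs_chainGauge_le {rr : Fin (d + 1) → ℕ} (hrr : rr ∈ box (d + 1) Lc) (m k : ℕ) :
    ∃ Λ : ℝ, ∀ (μ : Fin (d + 1)) (z u : Site (d + 1)),
      |Psi (toSite rr) Lc m k (delta1 μ z) u - bmGaugeAt (toSite rr) (respStep (d := d) (Lc ^ m) (Lc ^ (m + k + 1)) μ z) Lc u| ≤ Λ := by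
  have hLc : 1 ≤ Lc := Nat.one_le_iff_ne_zero.2 (NeZero.ne Lc)
  -- a uniform bound for every undressed composite column with target level `m + k + 1`
  have hC : ∀ M : ℕ, ∃ C : ℝ, ∀ (μ : Fin (d + 1)) (z : Site (d + 1)) (l'' : Fin (d + 1)) (w' : Site (d + 1)),
      |respStep (d := d) M (Lc ^ (m + k + 1)) μ z l'' w'| ≤ C := fun M => exists_abs_respStep_le (N' := Lc ^ (m + k + 1)) M
  choose C hC using hC
  refine ⟨(∑ i ∈ Finset.range k, |((Lc : ℝ) ^ ((d + 1) * (i + 1)))⁻¹| * (2 * ((((d + 1 : ℕ) : ℝ)) * Lc * C (Lc ^ (m + i + 1)))))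
      + 2 * ((((d + 1 : ℕ) : ℝ)) * Lc * C (Lc ^ m)), fun μ z u => ?_⟩
  have hΨ : |Psi (toSite rr) Lc m k (delta1 μ z) u|
      ≤ ∑ i ∈ Finset.range k, |((Lc : ℝ) ^ ((d + 1) * (i + 1)))⁻¹| * (2 * ((((d + 1 : ℕ) : ℝ)) * Lc * C (Lc ^ (m + i + 1)))) := by
    rw [Psi_apply, abs_neg]
    refine (Finset.abs_sum_le_sum_abs _ _).trans (Finset.sum_le_sum fun i _ => ?_)
    rw [abs_mul]
    refine mul_le_mul_of_nonneg_left ?_ (abs_nonneg _)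
    rw [legAct_delta1_eq]
    exact abs_bmGaugeAt_le hLc hrr (fun κ w => hC (Lc ^ (m + i + 1)) μ z κ w) _
  have hB : |bmGaugeAt (toSite rr) (respStep (d := d) (Lc ^ m) (Lc ^ (m + k + 1)) μ z) Lc u| ≤ 2 * ((((d + 1 : ℕ) : ℝ)) * Lc * C (Lc ^ m)) :=
    abs_bmGaugeAt_le hLc hrr (fun κ w => hC (Lc ^ m) μ z κ w) _
  exact (abs_sub _ _).trans (add_le_add hΨ hB)

/-! ## §2 Co-closed letters: the whole dressed chain of table legs is the undressed composite column -/

section CoClosed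

variable {rr : Fin (d + 1) → ℕ} (hrr : rr ∈ box (d + 1) Lc) (m k : ℕ)
  {S : Fin (d + 1) → Site (d + 1) → MKer (d + 1) (Fib d)} (hSs : ∀ κ x z a b, Summable fun u => S κ u x z a b)

include hrr hSs in
/-- NOT IN PRINT; OUR BOOKKEEPING.  **THE TABLE VERTEX THROUGH THE DRESSED CHAIN = THROUGH THE UNDRESSED COMPOSITE COLUMN + THE CHAIN's GAUGE FUNCTION AGAINST THE SLOT
DIVERGENCE**: for a slot-summable letter `S`, every depth `k`, every coarse bond `(κ′, u′)` and kernel entry,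
`vertexW (legChain (respStepBmSeq ρ Lc) m k) S κ′ u′ x z a b = vertexW (respStep (Lc^m) (Lc^(m+k+1))) S κ′ u′ x z a b + Σ'_u λ_{κ′u′}(u)·(divV S u) x z a b`. -/
theorem vertexW_legChain_eq_add_tsum (κ' : Fin (d + 1)) (u' x z : Site (d + 1)) (a b : Fib d) :
    vertexW (legChain (respStepBmSeq (d := d) (toSite rr) Lc) m k) S κ' u' x z a b
      = vertexW (respStep (d := d) (Lc ^ m) (Lc ^ (m + k + 1))) S κ' u' x z a b
        + ∑' u, (Psi (toSite rr) Lc m k (delta1 κ' u') u - bmGaugeAt (toSite rr) (respStep (d := d) (Lc ^ m) (Lc ^ (m + k + 1)) κ' u') Lc u)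
            * divV S u x z a b := by
  obtain ⟨Λ, hΛ⟩ := exists_abs_chainGauge_le (d := d) hrr m k
  obtain ⟨C, hC⟩ := exists_abs_respStep_le (N' := Lc ^ (m + k + 1)) (d := d) (Lc ^ m)
  -- the gauge leg family of the chain
  set lam : Fin (d + 1) → Site (d + 1) → Site (d + 1) → ℝ := fun μ y u =>
    Psi (toSite rr) Lc m k (delta1 μ y) u - bmGaugeAt (toSite rr) (respStep (d := d) (Lc ^ m) (Lc ^ (m + k + 1)) μ y) Lc u with hlam_def
  have hlam : ∀ ν U u, |lam ν U u| ≤ Λ := fun ν U u => hΛ ν U u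
  -- slot summation by parts for the gauge leg
  have hparts := vertexW_dz_eq_tsum_mul_divV (S := S) (lam := lam) hlam (hSs · x z a b) κ' u'
  rw [← hparts, vertexW_apply, vertexW_apply, vertexW_apply, ← Finset.sum_add_distrib]
  refine Finset.sum_congr rfl fun κ _ => ?_
  have hU : Summable fun u => respStep (d := d) (Lc ^ m) (Lc ^ (m + k + 1)) κ' u' κ u * S κ u x z a b :=
    Summable.of_norm_bounded ((hSs κ x z a b).abs.mul_left C) fun u => by
      rw [Real.norm_eq_abs, abs_mul]; exact mul_le_mul_of_nonneg_right (hC κ' u' κ u) (abs_nonneg _)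
  have hG : Summable fun u => dz (lam κ' u') κ u * S κ u x z a b :=
    Summable.of_norm_bounded ((hSs κ x z a b).abs.mul_left (Λ + Λ)) fun u => by
      rw [Real.norm_eq_abs, abs_mul]
      refine mul_le_mul_of_nonneg_right ?_ (abs_nonneg _)
      simp only [dz]
      exact (abs_sub _ _).trans (add_le_add (hlam _ _ _) (hlam _ _ _))
  rw [← hU.tsum_add hG]
  refine tsum_congr fun u => ?_
  rw [legChain_respStepBmSeq_apply_eq_add_dz hrr m k κ' u' κ u, add_mul]
  rfl

include hrr hSs in
/-- NOT IN PRINT; OUR BOOKKEEPING.  **ON A CO-CLOSED LETTER THE DRESSED CHAIN OF TABLE LEGS IS THE UNDRESSED COMPOSITE COLUMN** (every depth `k`, exactly):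
`divV S ≡ 0 ⇒ vertexW (legChain (respStepBmSeq ρ Lc) m k) S κ′ u′ = vertexW (respStep (Lc^m) (Lc^(m+k+1))) S κ′ u′`. -/
theorem vertexW_legChain_eq_of_divFree (hdiv : ∀ u, divV S u = 0) (κ' : Fin (d + 1)) (u' : Site (d + 1)) :
    vertexW (legChain (respStepBmSeq (d := d) (toSite rr) Lc) m k) S κ' u' = vertexW (respStep (d := d) (Lc ^ m) (Lc ^ (m + k + 1))) S κ' u' := by
  funext x z a b
  rw [vertexW_legChain_eq_add_tsum hrr m k hSs]
  have h0 : ∀ u, divV S u x z a b = 0 := fun u => by rw [hdiv u]; rfl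
  simp only [h0, mul_zero, tsum_zero, add_zero]

include hrr hSs in
/-- NOT IN PRINT; OUR BOOKKEEPING.  **THE TABLE THIRD OF K-LL-4 IS ABSENT ON CO-CLOSED LETTERS, AT THE COMPOSITE LEVEL**: for ALL kernel legs `l, r`, every depth `k` and
every slot-summable letter `S` with `divV S ≡ 0`, `push₃ l r (legChain (respStepBmSeq ρ Lc) m k) S = push₃ l r (respStep (Lc^m) (Lc^(m+k+1))) S`. -/
theorem push₃_legChain_table_eq_of_divFree (hdiv : ∀ u, divV S u = 0) (l r : LegFam d) (κ' : Fin (d + 1)) (u' : Site (d + 1)) :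
    push₃ l r (legChain (respStepBmSeq (d := d) (toSite rr) Lc) m k) S κ' u' = push₃ l r (respStep (d := d) (Lc ^ m) (Lc ^ (m + k + 1))) S κ' u' := by
  rw [push₃_def, push₃_def, vertexW_legChain_eq_of_divFree hrr m k hSs hdiv]

end CoClosed

/-! ## §3 Flux-free letters: exactly the outermost dressing survives -/

omit [NeZero Lc] in
/-- [folklore] **`Ψ` FACTORS THROUGH THE `Lc`-BLOCK LABEL** (it reads its gauges at `blk (Lc^(i+1)) u = blk (Lc^i) (blk Lc u)`):
`Psi ρ Lc m k b u = G (blk Lc u)` with `G B := −Σ_{i<k} (Lc^{(d+1)(i+1)})⁻¹ · bmGaugeAt ρ (legAct (respStep (Lc^(m+i+1)) (Lc^(m+k+1))) b) Lc (blk (Lc^i) B)`. -/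
theorem Psi_eq_blk [NeZero Lc] (ρ : Fin (d + 1) → ℤ) (m k : ℕ) (b : Form1 (d + 1) ℝ) (u : Site (d + 1)) :
    Psi ρ Lc m k b u = (fun B : Site (d + 1) => -∑ i ∈ Finset.range k, ((Lc : ℝ) ^ ((d + 1) * (i + 1)))⁻¹ *
      bmGaugeAt ρ (legAct (respStep (d := d) (Lc ^ (m + i + 1)) (Lc ^ (m + k + 1))) b) Lc (blk (Lc ^ i) B)) (blk Lc u) := by
  rw [Psi_apply]
  simp only
  congr 1
  refine Finset.sum_congr rfl fun i _ => ?_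
  rw [blk_blk (Lc ^ i) Lc u, ← pow_succ']

omit [NeZero Lc] in
open Classical in
/-- [folklore] **A BOUNDED `Lc`-BLOCK-CONSTANT WEIGHT AGAINST THE SLOT DIVERGENCE OF A FLUX-FREE LETTER SUMS TO ZERO** (block regrouping `tsum_blockConst_mul` ⨾ the block
indicator series is the block flux). -/
theorem tsum_blockConst_mul_divV_eq_zero_of_fluxFree (hLc : 1 ≤ Lc) {G : Site (d + 1) → ℝ} {Gbar : ℝ} (hG : ∀ B, |G B| ≤ Gbar)
    {S : Fin (d + 1) → Site (d + 1) → MKer (d + 1) (Fib d)} {x z : Site (d + 1)} {a b : Fib d} (hSs : ∀ κ, Summable fun u => S κ u x z a b)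
    (hflux : ∀ Y : Site (d + 1), ∑ v ∈ box (d + 1) Lc, divV S ((Lc : ℤ) • Y + toSite v) = 0) :
    ∑' u, G (blk Lc u) * divV S u x z a b = 0 := by
  have hD := summable_divV_apply (S := S) (x := x) (z := z) (a := a) (b := b) hSs
  have hGD : Summable fun u => G (blk Lc u) * divV S u x z a b :=
    Summable.of_norm_bounded (hD.abs.mul_left Gbar) fun u => by
      rw [Real.norm_eq_abs, abs_mul]; exact mul_le_mul_of_nonneg_right (hG _) (abs_nonneg _)
  rw [tsum_blockConst_mul Lc G hGD]
  refine (tsum_congr fun B => ?_).trans tsum_zero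
  rw [tsum_ite_blk_eq_sum_box hLc B, ← Finset.sum_apply, ← Finset.sum_apply, ← Finset.sum_apply, ← Finset.sum_apply, hflux B]
  simp

section FluxFree

variable {rr : Fin (d + 1) → ℕ} (hrr : rr ∈ box (d + 1) Lc) (m k : ℕ)
  {S : Fin (d + 1) → Site (d + 1) → MKer (d + 1) (Fib d)} (hSs : ∀ κ x z a b, Summable fun u => S κ u x z a b)
  (hflux : ∀ Y : Site (d + 1), ∑ v ∈ box (d + 1) Lc, divV S ((Lc : ℤ) • Y + toSite v) = 0)

include hrr hSs hflux in
/-- NOT IN PRINT; OUR BOOKKEEPING.  **ON A FLUX-FREE LETTER THE DRESSED CHAIN OF TABLE LEGS IS THE ONE-SHOT DRESSED COMPOSITE COLUMN** (every depth `k`, exactly): if every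
`Lc`-block flux of the slot-summable letter `S` vanishes, `vertexW (legChain (respStepBmSeq ρ Lc) m k) S κ′ u′ = vertexW (respStepBm ρ Lc (Lc^m) (Lc^(m+k+1))) S κ′ u′` — the
intermediate block-constant gauges `Ψ` drop out (§3 bricks), the outermost `−dz∘bmGaugeAt` is the window `bmW` (`axProjBmAt_eq_coProjBmW`). -/
theorem vertexW_legChain_eq_respStepBm_of_fluxFree (κ' : Fin (d + 1)) (u' : Site (d + 1)) :
    vertexW (legChain (respStepBmSeq (d := d) (toSite rr) Lc) m k) S κ' u'
      = vertexW (respStepBm (d := d) (toSite rr) Lc (Lc ^ m) (Lc ^ (m + k + 1))) S κ' u' := by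
  have hLc : 1 ≤ Lc := Nat.one_le_iff_ne_zero.2 (NeZero.ne Lc)
  obtain ⟨C, hC⟩ := exists_abs_respStep_le (N' := Lc ^ (m + k + 1)) (d := d) (Lc ^ m)
  -- the outermost gauge alone, as a leg family, is bounded
  set lam0 : Fin (d + 1) → Site (d + 1) → Site (d + 1) → ℝ := fun μ y u =>
    -bmGaugeAt (toSite rr) (respStep (d := d) (Lc ^ m) (Lc ^ (m + k + 1)) μ y) Lc u with hlam0_def
  have hlam0 : ∀ ν U u, |lam0 ν U u| ≤ 2 * ((((d + 1 : ℕ) : ℝ)) * Lc * C) := fun ν U u => by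
    rw [hlam0_def]; simp only [abs_neg]; exact abs_bmGaugeAt_le hLc hrr (fun κ w => hC ν U κ w) u
  -- the block-constant part's bound
  have hCi : ∀ M : ℕ, ∃ C : ℝ, ∀ (μ : Fin (d + 1)) (z : Site (d + 1)) (l'' : Fin (d + 1)) (w' : Site (d + 1)),
      |respStep (d := d) M (Lc ^ (m + k + 1)) μ z l'' w'| ≤ C := fun M => exists_abs_respStep_le (N' := Lc ^ (m + k + 1)) M
  choose Ci hCi using hCi
  funext x z a b
  rw [vertexW_legChain_eq_add_tsum hrr m k hSs]
  -- split the gauge function: block-constant `Ψ` part + outermost part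
  have hD := summable_divV_apply (S := S) (x := x) (z := z) (a := a) (b := b) (hSs · x z a b)
  set G : Site (d + 1) → ℝ := fun B => -∑ i ∈ Finset.range k, ((Lc : ℝ) ^ ((d + 1) * (i + 1)))⁻¹ *
      bmGaugeAt (toSite rr) (legAct (respStep (d := d) (Lc ^ (m + i + 1)) (Lc ^ (m + k + 1))) (delta1 κ' u')) Lc (blk (Lc ^ i) B) with hG_def
  have hGb : ∀ B, |G B| ≤ ∑ i ∈ Finset.range k, |((Lc : ℝ) ^ ((d + 1) * (i + 1)))⁻¹| * (2 * ((((d + 1 : ℕ) : ℝ)) * Lc * Ci (Lc ^ (m + i + 1)))) := by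
    intro B
    rw [hG_def]; simp only [abs_neg]
    refine (Finset.abs_sum_le_sum_abs _ _).trans (Finset.sum_le_sum fun i _ => ?_)
    rw [abs_mul]
    refine mul_le_mul_of_nonneg_left ?_ (abs_nonneg _)
    rw [legAct_delta1_eq]
    exact abs_bmGaugeAt_le hLc hrr (fun κ w => hCi (Lc ^ (m + i + 1)) κ' u' κ w) _
  have hΨ : ∀ u, Psi (toSite rr) Lc m k (delta1 κ' u') u = G (blk Lc u) := fun u => by rw [Psi_eq_blk]
  have e1 : ∀ u, (Psi (toSite rr) Lc m k (delta1 κ' u') u - bmGaugeAt (toSite rr) (respStep (d := d) (Lc ^ m) (Lc ^ (m + k + 1)) κ' u') Lc u)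
        * divV S u x z a b = G (blk Lc u) * divV S u x z a b + lam0 κ' u' u * divV S u x z a b := fun u => by
    rw [hΨ u, hlam0_def]; ring
  have hs1 : Summable fun u => G (blk Lc u) * divV S u x z a b :=
    Summable.of_norm_bounded (hD.abs.mul_left _) fun u => by
      rw [Real.norm_eq_abs, abs_mul]; exact mul_le_mul_of_nonneg_right (hGb _) (abs_nonneg _)
  have hs2 : Summable fun u => lam0 κ' u' u * divV S u x z a b :=
    Summable.of_norm_bounded (hD.abs.mul_left _) fun u => by
      rw [Real.norm_eq_abs, abs_mul]; exact mul_le_mul_of_nonneg_right (hlam0 _ _ _) (abs_nonneg _)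
  rw [tsum_congr e1, hs1.tsum_add hs2, tsum_blockConst_mul_divV_eq_zero_of_fluxFree hLc hGb (hSs · x z a b) hflux, zero_add,
    ← vertexW_dz_eq_tsum_mul_divV (S := S) (lam := lam0) hlam0 (hSs · x z a b) κ' u']
  -- the one-shot dressed column is the undressed one plus the outermost pure gauge
  rw [respStepBm_def, vertexW_apply, vertexW_apply, vertexW_apply, ← Finset.sum_add_distrib]
  refine Finset.sum_congr rfl fun κ _ => ?_
  have hU : Summable fun u => respStep (d := d) (Lc ^ m) (Lc ^ (m + k + 1)) κ' u' κ u * S κ u x z a b :=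
    Summable.of_norm_bounded ((hSs κ x z a b).abs.mul_left C) fun u => by
      rw [Real.norm_eq_abs, abs_mul]; exact mul_le_mul_of_nonneg_right (hC κ' u' κ u) (abs_nonneg _)
  have hGl : Summable fun u => dz (lam0 κ' u') κ u * S κ u x z a b :=
    Summable.of_norm_bounded ((hSs κ x z a b).abs.mul_left (2 * ((((d + 1 : ℕ) : ℝ)) * Lc * C) + 2 * ((((d + 1 : ℕ) : ℝ)) * Lc * C))) fun u => by
      rw [Real.norm_eq_abs, abs_mul]
      refine mul_le_mul_of_nonneg_right ?_ (abs_nonneg _)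
      simp only [dz]
      exact (abs_sub _ _).trans (add_le_add (hlam0 _ _ _) (hlam0 _ _ _))
  rw [← hU.tsum_add hGl]
  refine tsum_congr fun u => ?_
  rw [← add_mul]
  congr 1
  show _ = bmW (toSite rr) Lc (respStep (d := d) (Lc ^ m) (Lc ^ (m + k + 1))) κ' u' κ u
  rw [bmW, ← axProjBmAt_eq_coProjBmW hLc hrr, axProjBmAt, ← grad_eq_dz, hlam0_def]
  simp only [Pi.sub_apply, AveragingContours.grad]
  ring

include hrr hSs hflux in
/-- NOT IN PRINT; OUR BOOKKEEPING.  **ON A FLUX-FREE LETTER THE CHAIN OF DRESSED TABLE LEGS COSTS EXACTLY ONE DRESSING**: for ALL kernel legs `l, r`, every depth `k`,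
`push₃ l r (legChain (respStepBmSeq ρ Lc) m k) S = push₃ l r (respStepBm ρ Lc (Lc^m) (Lc^(m+k+1))) S` — RULING R-gan24p1-g29-1 (E) (CC) «the first push of a born
interior letter costs the base count once, then nothing» at the COMPOSITE level, as an identity (no iteration, no propagation lemma needed). -/
theorem push₃_legChain_table_eq_respStepBm_of_fluxFree (l r : LegFam d) (κ' : Fin (d + 1)) (u' : Site (d + 1)) :
    push₃ l r (legChain (respStepBmSeq (d := d) (toSite rr) Lc) m k) S κ' u'
      = push₃ l r (respStepBm (d := d) (toSite rr) Lc (Lc ^ m) (Lc ^ (m + k + 1))) S κ' u' := by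
  rw [push₃_def, push₃_def, vertexW_legChain_eq_respStepBm_of_fluxFree hrr m k hSs hflux]

end FluxFree

/-! ## §4 The END's currency: the unit transport of a co-closed ∕ flux-free letter -/

section Transport

variable {rr : Fin (d + 1) → ℕ} (hrr : rr ∈ box (d + 1) Lc) (cE : ℝ) (m : ℕ)
  {X : Fin (d + 1) → Site (d + 1) → MKer (d + 1) (Fib d)} (hX : ∀ κ u, IsFF (X κ u)) (hXl : ∃ Cs δ : ℝ, 0 < δ ∧ LocStencil X Cs δ)

include hrr hX hXl in
/-- NOT IN PRINT; OUR BOOKKEEPING.  **THE UNIT TRANSPORT OF A CO-CLOSED ff LETTER HAS an2's UNDRESSED COMPOSITE COLUMN AS ITS TABLE LEG**: for an ff-valued local letter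
`X` at level `m` with `divV X ≡ 0`, `transport unitStepMap m (n+1) X = (cE·Lc^{2(d+1)})^{n+1} • push₃ (legChain T m n) (legChain T m n) (respStep (Lc^m) (Lc^(m+n+1))) X`
(`SrecBornSector.transport_unitStepMap_succ_eq_push₃` ⨾ §2) — the (Q-R)^{cc} table leg in the composite END is the (UUU)∕(LT-UUU) leg. -/
theorem transport_unitStepMap_succ_eq_push₃_respStep_of_divFree (hdiv : ∀ u, divV X u = 0) (n : ℕ) :
    transport (unitStepMap Lc (toSite rr) cE) m (n + 1) X = fun κ' u' => (cE * (Lc : ℝ) ^ (2 * (d + 1))) ^ (n + 1) •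
      push₃ (legChain (respStepBmSeq (toSite rr) Lc) m n) (legChain (respStepBmSeq (toSite rr) Lc) m n)
        (respStep (d := d) (Lc ^ m) (Lc ^ (m + n + 1))) X κ' u' := by
  obtain ⟨Cs, δ, hδ, hXs⟩ := hXl
  have hSs : ∀ κ x z a b, Summable fun u => X κ u x z a b := fun κ x z a b => summable_stencil_slot hXs hδ κ x z a b
  rw [transport_unitStepMap_succ_eq_push₃ hrr cE m hX ⟨Cs, δ, hδ, hXs⟩ n]
  funext κ' u'
  rw [push₃_legChain_table_eq_of_divFree hrr m n hSs hdiv]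

include hrr hX hXl in
/-- NOT IN PRINT; OUR BOOKKEEPING.  **THE UNIT TRANSPORT OF A FLUX-FREE ff LETTER HAS THE ONE-SHOT DRESSED COMPOSITE COLUMN AS ITS TABLE LEG**: for an ff-valued local letter
`X` at level `m` all of whose `Lc`-block fluxes vanish, `transport unitStepMap m (n+1) X = (cE·Lc^{2(d+1)})^{n+1} • push₃ (legChain T m n) (legChain T m n)
(respStepBm ρ Lc (Lc^m) (Lc^(m+n+1))) X` (§3) — RULING (E) (CC) in the END's currency: ONE dressing for an interior born letter, at its first push, then none. -/
theorem transport_unitStepMap_succ_eq_push₃_respStepBm_of_fluxFree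
    (hflux : ∀ Y : Site (d + 1), ∑ v ∈ box (d + 1) Lc, divV X ((Lc : ℤ) • Y + toSite v) = 0) (n : ℕ) :
    transport (unitStepMap Lc (toSite rr) cE) m (n + 1) X = fun κ' u' => (cE * (Lc : ℝ) ^ (2 * (d + 1))) ^ (n + 1) •
      push₃ (legChain (respStepBmSeq (toSite rr) Lc) m n) (legChain (respStepBmSeq (toSite rr) Lc) m n)
        (respStepBm (d := d) (toSite rr) Lc (Lc ^ m) (Lc ^ (m + n + 1))) X κ' u' := by
  obtain ⟨Cs, δ, hδ, hXs⟩ := hXl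
  have hSs : ∀ κ x z a b, Summable fun u => X κ u x z a b := fun κ x z a b => summable_stencil_slot hXs hδ κ x z a b
  rw [transport_unitStepMap_succ_eq_push₃ hrr cE m hX ⟨Cs, δ, hδ, hXs⟩ n]
  funext κ' u'
  rw [push₃_legChain_table_eq_respStepBm_of_fluxFree hrr m n hSs hflux]

end Transport

end Summit.QuantumFields.BalabanUV.Beta.GAN24.ChainTableLegCoClosed

end
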